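import Summits.Ventures.GridStability.Bench.WSCC9Deg4ASosgramDinstChk2
import Summits.Ventures.GridStability.Bench.WSCC9Deg4ASosgramDinstChk3
import Summits.Ventures.GridStability.Bench.WSCC9Deg4ASosgramDinstData1
import Summits.Ventures.GridStability.Bench.WSCC9Deg4ASosgramDinstData11
import Summits.Ventures.GridStability.Bench.WSCC9Deg4ASosgramDinstData14
import Summits.Ventures.GridStability.Bench.WSCC9Deg4ASosgramDinstData15
import Summits.Ventures.GridStability.Bench.WSCC9Deg4ASosgramDinstData19
import Summits.Ventures.GridStability.Bench.WSCC9Deg4ASosgramDinstData20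
import Summits.Ventures.GridStability.Bench.WSCC9Deg4ASosgramDinstPsd4
import Summits.Ventures.GridStability.Bench.WSCC9Deg4ASosgramDinstPsd5
import Mathlib.Tactic.LinearCombination
import Mathlib.Tactic.Positivity
import Literature.Computation.Certificates.GramSOSRows
import Literature.Computation.Certificates.Blocks
import Literature.Computation.Certificates.PosSemidefIntList
import Literature.Computation.Certificates.GramSOSList
import HarnessLib
-- import re-plumb (gridfusion-sos-3 g3, 2026-08-27): this file = emitter v0.9 output (kit j267541) with ONLY its `import` block
-- rewritten to the shards it actually references (the emitted linear chain Data k → Data k−1 costs one hub olean-build wait per file).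
-- PORT cert/sos-5/emit_lean.py@a0fbeb927efb3b7b / source WSCC9-deg4-A-sosgram-Dinst.json sha256: 9d83c75afa575de83560d25f77d549e4d3648c3bbe936f375082822466631ae6
-- estimated kernel time of this file's `decide`s: 134 s (emitter calibration 2026-08-26; RULING 8 budget 250 s per file)

/-!
# Ventures/GridStability — Bench/WSCC9Deg4ASosgramDinstPart3.lean: PART 3 of 3 of certificate file `WSCC9-deg4-A-sosgram-Dinst` (system WSCC9, V degree 4, toolchain A)

Kernel checks and certified inequalities for the identities `deg4_A_sosgram_Dinst_dom_incl_1` of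
certificate `WSCC9-deg4-A-sosgram-Dinst` (data in
`Summits.Ventures.GridStability.Bench.WSCC9Deg4ASosgramDinstData`); the conjunction
`deg4_A_sosgram_Dinst_certificate` and the full docstring (three columns, provenance, identity list)
are in `Bench/WSCC9Deg4ASosgramDinst.lean`. Split by the emitter so that each file's `decide
+kernel` time stays inside the RULING 8 budget (estimated 134 s here). «algebraic inequalities
certified; ROA inclusion pending Lyapunov/ lemma».
-/

namespace Summit.Ventures.GridStability.Bench.WSCC9

open Literature.Computation.Certificates Literature.Computation.Certificates.SOS
open Literature.Computation.Certificates.SOS.Poly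

/-! ### Kernel checks (`decide +kernel`) — data in `Summits.Ventures.GridStability.Bench.WSCC9Deg4ASosgramDinstData` -/

/-- ℤ-LIST SYMMETRY CHECK of `deg4_A_sosgram_Dinst_dom_incl_1_free_zA` (`PSD.symCheckZ`, one `decide`). [folklore] -/
theorem deg4_A_sosgram_Dinst_dom_incl_1_free_zsym : PSD.symCheckZ 104 deg4_A_sosgram_Dinst_dom_incl_1_free_zA = true := by
  decide +kernel

/-- INTEGER ROUNDED GRAM CERTIFICATE of `deg4_A_sosgram_Dinst_dom_incl_1_free` (`PSD.IsGramCertZ` of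
`(zA, zd, zBT)`), assembled from the symmetry check and the 6 row blocks
(`PSD.IsGramCertZ.of_listCheck'`, `forall_fin_of_blocks 20`). [folklore] -/
theorem deg4_A_sosgram_Dinst_dom_incl_1_free_zcert :
    PSD.IsGramCertZ (matrixOfRows 104 104 deg4_A_sosgram_Dinst_dom_incl_1_free_zA) (vecOfList 104 deg4_A_sosgram_Dinst_dom_incl_1_free_zd) (matrixOfCols 104 104 deg4_A_sosgram_Dinst_dom_incl_1_free_zBT) :=
  PSD.IsGramCertZ.of_listCheck' deg4_A_sosgram_Dinst_dom_incl_1_free_zsym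
    (forall_fin_of_blocks 20 (by norm_num) (by intro c; fin_cases c; exacts [deg4_A_sosgram_Dinst_dom_incl_1_free_zr0, deg4_A_sosgram_Dinst_dom_incl_1_free_zr1, deg4_A_sosgram_Dinst_dom_incl_1_free_zr2, deg4_A_sosgram_Dinst_dom_incl_1_free_zr3, deg4_A_sosgram_Dinst_dom_incl_1_free_zr4, deg4_A_sosgram_Dinst_dom_incl_1_free_zr5]))

set_option maxHeartbeats 0 in
/-- FORM-AGNOSTIC PSD FACT of `deg4_A_sosgram_Dinst_dom_incl_1_freeL` (L-lane): the quadratic form of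
`Q` is nonnegative — `GramL.quadNonneg_of_gramCertZ` from the integer certificate
`deg4_A_sosgram_Dinst_dom_incl_1_free_zcert`, the scale `c := N` and the list-computed scale test
`GramL.scaleOK` (`A = N·Q` entrywise, one `decide`). [folklore] -/
theorem deg4_A_sosgram_Dinst_dom_incl_1_freeL_quad : deg4_A_sosgram_Dinst_dom_incl_1_freeL.toGramSOS.QuadNonneg ℝ :=
  deg4_A_sosgram_Dinst_dom_incl_1_freeL.quadNonneg_of_gramCertZ deg4_A_sosgram_Dinst_dom_incl_1_free_zcert (c := (deg4_A_sosgram_Dinst_dom_incl_1_free_zN : ℚ)) (by norm_num [deg4_A_sosgram_Dinst_dom_incl_1_free_zN]) (by decide +kernel)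

set_option maxHeartbeats 0 in
/-- KERNEL PSD CHECK `deg4_A_sosgram_Dinst_dom_incl_1_ineq1` (size 8): `d ≥ 0` and `Q − Bᵀ·diag d·B` symmetric diagonally dominant. [folklore] -/
theorem deg4_A_sosgram_Dinst_dom_incl_1_ineq1_valid : PSD.IsGramCertDD (matrixOfRows 8 8 deg4_A_sosgram_Dinst_dom_incl_1_ineq1_Q) (vecOfList 8 deg4_A_sosgram_Dinst_dom_incl_1_ineq1_d) (matrixOfRows 8 8 deg4_A_sosgram_Dinst_dom_incl_1_ineq1_B) := by
  decide +kernel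

/-- Form-agnostic PSD fact of `deg4_A_sosgram_Dinst_dom_incl_1_ineq1L` from the block's rounded rational certificate (`GramSOS.quadNonneg_of_valid` through the `GramL` view). [folklore] -/
theorem deg4_A_sosgram_Dinst_dom_incl_1_ineq1L_quad : deg4_A_sosgram_Dinst_dom_incl_1_ineq1L.toGramSOS.QuadNonneg ℝ :=
  deg4_A_sosgram_Dinst_dom_incl_1_ineq1L.toGramSOS.quadNonneg_of_valid deg4_A_sosgram_Dinst_dom_incl_1_ineq1_valid

/-- L8 CHUNK EQUALITIES of `deg4_A_sosgram_Dinst_dom_incl_1` assembled (`GramL.ChunkEqs 0 [40, 40,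
24]`): the shipped partial sums tile all 104 rows of the free block. [folklore] -/
theorem deg4_A_sosgram_Dinst_dom_incl_1_chunks : deg4_A_sosgram_Dinst_dom_incl_1_freeL.ChunkEqs 0 [40, 40, 24] [deg4_A_sosgram_Dinst_dom_incl_1_P0, deg4_A_sosgram_Dinst_dom_incl_1_P1, deg4_A_sosgram_Dinst_dom_incl_1_P2] :=
  ⟨deg4_A_sosgram_Dinst_dom_incl_1_chunk0, deg4_A_sosgram_Dinst_dom_incl_1_chunk1, deg4_A_sosgram_Dinst_dom_incl_1_chunk2, trivial⟩

set_option maxHeartbeats 0 in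
/-- KERNEL RESIDUAL CHECK `deg4_A_sosgram_Dinst_dom_incl_1` (L8 lane, GramSOSList `residualL`: the free
block enters through its certified partial sums): `p − (Σ_t P_t + Σ gᵢσᵢ + Σ hⱼtⱼ)` is the zero
polynomial. [folklore] -/
theorem deg4_A_sosgram_Dinst_dom_incl_1_residualL :
    isZero (residualL deg4_A_sosgram_Dinst_dom_incl_1_p deg4_A_sosgram_Dinst_dom_incl_1_gsL deg4_A_sosgram_Dinst_dom_incl_1_hs [deg4_A_sosgram_Dinst_dom_incl_1_P0, deg4_A_sosgram_Dinst_dom_incl_1_P1, deg4_A_sosgram_Dinst_dom_incl_1_P2] deg4_A_sosgram_Dinst_dom_incl_1_ineqL deg4_A_sosgram_Dinst_dom_incl_1_eqMult) = true := by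
  decide +kernel

set_option maxHeartbeats 0 in
/-- LINK `deg4_A_sosgram_Dinst_dom_incl_1_g0` (level): `Poly.add deg4_A_sosgram_Dinst_dom_incl_1_g0 (Poly.add deg4_A_sosgram_Dinst_V_poly (Poly.C ((-1159 : ℚ)/1000)))` is the zero polynomial (kernel zero test). [folklore] -/
theorem deg4_A_sosgram_Dinst_dom_incl_1_g0_link : isZero (Poly.add deg4_A_sosgram_Dinst_dom_incl_1_g0 (Poly.add deg4_A_sosgram_Dinst_V_poly (Poly.C ((-1159 : ℚ)/1000)))) = true := by
  decide +kernel

/-! ### The certified inequalities (README §3 T3; «algebraic inequalities certified; ROA inclusion pending Lyapunov/ lemma») -/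

/-- **`deg4_A_sosgram_Dinst_dom_incl_1`** (CERTIFIED, model `WSCC9 instance WSCC9-postB-SPdamp-h12
(model-1 WSCC9-poly.json)`; ALGEBRAIC inequality, ROA inclusion pending Lyapunov/ lemma): domain
polynomial g_1 >= 0 on {level - V >= 0} cap {h = 0} (the sublevel set lies inside D: arc exclusion,
PARTITION A2/A6) — for every real point satisfying the listed hypotheses (hV, hh1, hh2). [folklore] -/
theorem deg4_A_sosgram_Dinst_dom_incl_1 (sigma_2 kappa_2 sigma_3 kappa_3 omega_1 omega_2 omega_3 : ℝ) (hV : deg4_A_sosgram_Dinst_V sigma_2 kappa_2 sigma_3 kappa_3 omega_1 omega_2 omega_3 ≤ (1159 / 1000 : ℝ)) (hh1 : deg4_A_sosgram_Dinst_h1 sigma_2 kappa_2 sigma_3 kappa_3 omega_1 omega_2 omega_3 = 0) (hh2 : deg4_A_sosgram_Dinst_h2 sigma_2 kappa_2 sigma_3 kappa_3 omega_1 omega_2 omega_3 = 0) :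
    0 ≤ (-1 : ℝ) * kappa_3 + ((3 : ℝ) / 2) := by
  simp only [deg4_A_sosgram_Dinst_V] at hV
  simp only [deg4_A_sosgram_Dinst_h1, deg4_A_sosgram_Dinst_h1_poly, eval_cons, eval_nil, Monomial.eval_eq, Monomial.evalFrom_cons, Monomial.evalFrom_nil,
        vars_cons_zero, vars_cons_succ] at hh1
  push_cast at hh1
  simp only [deg4_A_sosgram_Dinst_h2, deg4_A_sosgram_Dinst_h2_poly, eval_cons, eval_nil, Monomial.eval_eq, Monomial.evalFrom_cons, Monomial.evalFrom_nil,
        vars_cons_zero, vars_cons_succ] at hh2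
  push_cast at hh2
  have h := nonneg_of_chunksL (p := deg4_A_sosgram_Dinst_dom_incl_1_p) (gs := deg4_A_sosgram_Dinst_dom_incl_1_gsL) (hs := deg4_A_sosgram_Dinst_dom_incl_1_hs) (free := deg4_A_sosgram_Dinst_dom_incl_1_freeL) (ineq := deg4_A_sosgram_Dinst_dom_incl_1_ineqL)
    (eqMult := deg4_A_sosgram_Dinst_dom_incl_1_eqMult) (by decide) (by decide) deg4_A_sosgram_Dinst_dom_incl_1_chunks deg4_A_sosgram_Dinst_dom_incl_1_freeL_quad
    (by
      intro σ hσ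
      simp only [deg4_A_sosgram_Dinst_dom_incl_1_ineqL, List.mem_cons, List.not_mem_nil, or_false] at hσ
      rcases hσ with rfl
      · exact deg4_A_sosgram_Dinst_dom_incl_1_ineq1L_quad)
    deg4_A_sosgram_Dinst_dom_incl_1_residualL (vars [sigma_2, kappa_2, sigma_3, kappa_3, omega_1, omega_2, omega_3])
    (by
      intro g hg
      simp only [deg4_A_sosgram_Dinst_dom_incl_1_gsL, List.mem_cons, List.not_mem_nil, or_false] at hg
      rcases hg with rfl
      · have e := eval_eq_zero_of_isZero (vars [sigma_2, kappa_2, sigma_3, kappa_3, omega_1, omega_2, omega_3]) deg4_A_sosgram_Dinst_dom_incl_1_g0_link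
        rw [eval_add, eval_add, eval_C] at e
        push_cast at e
        linarith)
    (by
      intro q hq
      simp only [deg4_A_sosgram_Dinst_dom_incl_1_hs, List.mem_cons, List.not_mem_nil, or_false] at hq
      rcases hq with rfl | rfl
      · simp only [eval_cons, eval_nil, Monomial.eval_eq, Monomial.evalFrom_cons, Monomial.evalFrom_nil,
        vars_cons_zero, vars_cons_succ]
        push_cast
        linear_combination hh1
      · simp only [eval_cons, eval_nil, Monomial.eval_eq, Monomial.evalFrom_cons, Monomial.evalFrom_nil,
        vars_cons_zero, vars_cons_succ]
        push_cast
        linear_combination hh2)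
  simp only [deg4_A_sosgram_Dinst_dom_incl_1_p, eval_cons, eval_nil, Monomial.eval_eq, Monomial.evalFrom_cons, Monomial.evalFrom_nil,
        vars_cons_zero, vars_cons_succ] at h
  push_cast at h
  linear_combination h

end Summit.Ventures.GridStability.Bench.WSCC9
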